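import Mathlib
import HarnessLib.Audit
import Summits.PneNP.PneNP.Theorems.PstarChordBridgePointwise

/-!
# One GATED chord: reachable-form forcing, the direction of the other chords, and chamber incompatibility (ROUND-25, O2 / E2; prover-1 g18)

FRONTIER range-avoidance ladder, rung F-N3 (`stmt-PneNP-19007`), cell `pnp-ideate` (planner memo `r24/CORE-BOUND-NOTES.md` §14.34–14.35, nodes
`PstarCoupled.TerminalFiveCotree1Blind` / `PstarCoupledG.CoupledFourG`; prover-1 `O2-SCOPING.md` §4 "chamber coherence"); restricted-model proof complexity —
nothing here bears on `P` versus `NP`.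

THE E2 SITUATION IN THE MODEL.  After the fibre lemma, the blind cotree-partner gate is a terminal pair `(w₁ = R + x_p · ℓ_u, w₂)` whose bridge model
(`PstarChordBridge.sys`, available by `PstarChordBridgeAssemble.exists_bridgeData`, which needs no privates-unread) has CONSTANT read vectors for every
chord except ONE chord `e`, whose first private is read by the first constraint with the affine coefficient `ℓ_u(a)` — i.e. `ρ_e(a) ∈ {0, (1,0)}`
chamber by chamber — and whose second private is unread.  The clean chain (`PstarChordSystem.direction_collapse`, `star_star`) assumes all reads
constant.  This file supplies the three model facts that replace them (abstract `ChordSystem`, any base type):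

* `forced_of_reach_fst` / `forced_of_reach_snd` — **M-forced, reachable form**: in an infeasible system, at a base point where some admissible state
  hits the FIRST target coordinate, every chord read there only in the SECOND coordinate is forced ON (and symmetrically).  `PstarChordSystem.forced_of_read`
  is the special case "second coordinate state-free".  This is what forces the transversely-read chords on the ENLARGED reachability set
  `Z(R + ℓ + t₁) ∪ ({ℓ = 1} ∩ Z(u_e))` of the gated configuration (CASE T of the E2 analysis);
* `unread_of_unreach_snd` — if NO admissible state hits the second target coordinate at `a`, every chord killable at `a` is unread in the second
  coordinate (the `h = 1` sumset on the coupling region `{ℓ = 1} ∩ {u_e = 0}`, where the gated chord is killable but read);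
* `direction_of_others` — **direction collapse for all chords but one**: if every chord other than `e` has constant reads and any two chords are
  killable at a common base point, the reads of the chords other than `e` lie on one line `{0, m}` (U1) or exactly one of them is read, with
  independent reads (U2) — `PstarChordSystem.U1_or_U2_of_pairwise` fed by the POINTWISE `PstarChordBridgePointwise.not_killable_pair_at`, so that
  the non-constant read of `e` never enters;
* `not_cokillable_of_read` — **chamber incompatibility**: at a base point where the gated chord carries a non-zero read `x` and another chord
  carries a non-zero read `y ≠ x`, the two are not both killable (`not_killable_pair_at`, restated for use): in the transverse case the gate
  chamber `{ℓ = 1}` meets no common zero of `u_e` and `u_{e'}`.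

Pure model layer: no instance, no expansion.  The instance-level dichotomy (CASE P: `m = (1,0)`, `w₂` chord-blind, every chord ON on `Z(q)` and
`e` ON on `Z(q) ∩ {ℓ = 1}` by `forced_of_read_toX`; CASE T: `m` transverse) is assembled downstream.
-/

set_option linter.dupNamespace false -- `Summit.PneNP.PneNP.…`: summit = sub-problem name (D-0017 single-conjunct layout)

open Finset
open Summit.PneNP.PneNP.Theorems.PstarReadSumset (V2)
open Summit.PneNP.PneNP.Theorems.PstarChordSystem (ChordSystem)
open Summit.PneNP.PneNP.Theorems.PstarChordBridgePointwise (not_killable_pair_at)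

namespace Summit.PneNP.PneNP.Theorems.PstarGateDirection

variable {ι A : Type*} [DecidableEq ι] (S : ChordSystem ι A)

/-- Every element of `𝔽₂` is `0` or `1`. -/
private theorem zmod2_cases (t : ZMod 2) : t = 0 ∨ t = 1 := by
  revert t; decide

/-! ## M-forced, reachable form -/

/-- **M-forced, reachable form (first coordinate reachable).**  Infeasible system; at the base point `a` some admissible state hits the first
target coordinate; the chord `e ∈ E` is read at `a`, but only in the second coordinate.  Then `e` is forced ON at `a`: `u e a = 1`.
(Otherwise re-choose the killable state of `e` to repair the second coordinate — its first coordinate is untouched.) -/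
theorem forced_of_reach_fst {E : Finset ι} (hI : S.Infeasible E) {e : ι} (he : e ∈ E) {a : A}
    (hreach : ∃ s, S.Adm E a s ∧ (S.val E a s).1 = S.t.1) (h1 : (S.ρ e a).1 = 0 ∧ (S.ρ' e a).1 = 0) (hR : S.Read e a) :
    S.u e a = 1 := by
  rcases zmod2_cases (S.u e a) with hu | hu
  swap
  · exact hu
  exfalso
  obtain ⟨s, hadm, hs1⟩ := hreach
  -- the value without `e`
  set c := S.val (E.erase e) a s with hc
  have hsplit := S.val_eq he a s
  -- second coordinates of the reads: one of them is `1`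
  have hread2 : (S.ρ e a).2 = 1 ∨ (S.ρ' e a).2 = 1 := by
    rcases hR with h | h
    · left
      rcases zmod2_cases (S.ρ e a).2 with h2 | h2
      · exact absurd (Prod.ext h1.1 h2) h
      · exact h2
    · right
      rcases zmod2_cases (S.ρ' e a).2 with h2 | h2
      · exact absurd (Prod.ext h1.2 h2) h
      · exact h2
  -- the first coordinate does not see the state of `e`
  have hc1 : c.1 = S.t.1 := by
    have h := congrArg Prod.fst hsplit
    rw [Prod.fst_add] at h
    unfold ChordSystem.contrib at h
    rw [Prod.fst_add, Prod.smul_fst, Prod.smul_fst, h1.1, h1.2, smul_zero, smul_zero, zero_add, zero_add] at h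
    rw [← h]; exact hs1
  -- a killable state of `e` repairing the second coordinate
  obtain ⟨x, hx0, hx⟩ : ∃ x : ZMod 2 × ZMod 2, x.1 * x.2 = 0 ∧ (x.1 • S.ρ e a + x.2 • S.ρ' e a) + c = S.t := by
    rcases zmod2_cases (c.2 + S.t.2) with h0 | h0
    · refine ⟨(0, 0), by simp, ?_⟩
      rw [zero_smul, zero_smul, add_zero, zero_add]
      have e2 : ∀ p q : ZMod 2, p + q = 0 → p = q := by decide
      exact Prod.ext hc1 (e2 _ _ h0)
    · have e2 : ∀ p q : ZMod 2, p + q = 1 → 1 + p = q := by decide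
      rcases hread2 with h2 | h2
      · refine ⟨(1, 0), by simp, Prod.ext ?_ ?_⟩
        · rw [one_smul, zero_smul, add_zero, Prod.fst_add, h1.1, zero_add]; exact hc1
        · rw [one_smul, zero_smul, add_zero, Prod.snd_add, h2]; exact e2 _ _ h0
      · refine ⟨(0, 1), by simp, Prod.ext ?_ ?_⟩
        · rw [zero_smul, one_smul, zero_add, Prod.fst_add, h1.2, zero_add]; exact hc1
        · rw [zero_smul, one_smul, zero_add, Prod.snd_add, h2]; exact e2 _ _ h0
  refine hI a (Function.update s e x) (S.adm_update (S.adm_erase hadm e) (by rw [hx0, hu])) ?_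
  rw [S.val_eq he, S.val_erase_update, S.contrib_update_self, ← hc]
  exact hx

/-- **M-forced, reachable form (second coordinate reachable).**  The mirror image of `forced_of_reach_fst`: some admissible state hits the second
target coordinate at `a`, and `e ∈ E` is read at `a` only in the first coordinate ⟹ `u e a = 1`.  (With the second coordinate state-free this is
`PstarChordSystem.forced_of_read`.) -/
theorem forced_of_reach_snd {E : Finset ι} (hI : S.Infeasible E) {e : ι} (he : e ∈ E) {a : A}
    (hreach : ∃ s, S.Adm E a s ∧ (S.val E a s).2 = S.t.2) (h2 : (S.ρ e a).2 = 0 ∧ (S.ρ' e a).2 = 0) (hR : S.Read e a) :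
    S.u e a = 1 := by
  rcases zmod2_cases (S.u e a) with hu | hu
  swap
  · exact hu
  exfalso
  obtain ⟨s, hadm, hs2⟩ := hreach
  set c := S.val (E.erase e) a s with hc
  have hsplit := S.val_eq he a s
  have hread1 : (S.ρ e a).1 = 1 ∨ (S.ρ' e a).1 = 1 := by
    rcases hR with h | h
    · left
      rcases zmod2_cases (S.ρ e a).1 with h1 | h1
      · exact absurd (Prod.ext h1 h2.1) h
      · exact h1
    · right
      rcases zmod2_cases (S.ρ' e a).1 with h1 | h1
      · exact absurd (Prod.ext h1 h2.2) h
      · exact h1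
  have hc2 : c.2 = S.t.2 := by
    have h := congrArg Prod.snd hsplit
    rw [Prod.snd_add] at h
    unfold ChordSystem.contrib at h
    rw [Prod.snd_add, Prod.smul_snd, Prod.smul_snd, h2.1, h2.2, smul_zero, smul_zero, zero_add, zero_add] at h
    rw [← h]; exact hs2
  obtain ⟨x, hx0, hx⟩ : ∃ x : ZMod 2 × ZMod 2, x.1 * x.2 = 0 ∧ (x.1 • S.ρ e a + x.2 • S.ρ' e a) + c = S.t := by
    rcases zmod2_cases (c.1 + S.t.1) with h0 | h0
    · refine ⟨(0, 0), by simp, ?_⟩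
      rw [zero_smul, zero_smul, add_zero, zero_add]
      have e2 : ∀ p q : ZMod 2, p + q = 0 → p = q := by decide
      exact Prod.ext (e2 _ _ h0) hc2
    · have e2 : ∀ p q : ZMod 2, p + q = 1 → 1 + p = q := by decide
      rcases hread1 with h1 | h1
      · refine ⟨(1, 0), by simp, Prod.ext ?_ ?_⟩
        · rw [one_smul, zero_smul, add_zero, Prod.fst_add, h1]; exact e2 _ _ h0
        · rw [one_smul, zero_smul, add_zero, Prod.snd_add, h2.1, zero_add]; exact hc2
      · refine ⟨(0, 1), by simp, Prod.ext ?_ ?_⟩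
        · rw [zero_smul, one_smul, zero_add, Prod.fst_add, h1]; exact e2 _ _ h0
        · rw [zero_smul, one_smul, zero_add, Prod.snd_add, h2.2, zero_add]; exact hc2
  refine hI a (Function.update s e x) (S.adm_update (S.adm_erase hadm e) (by rw [hx0, hu])) ?_
  rw [S.val_eq he, S.val_erase_update, S.contrib_update_self, ← hc]
  exact hx

/-! ## The `h = 1` sumset on a region where the second coordinate is unreachable -/

/-- **Unreachable second coordinate ⟹ killable chords are unread there.**  If at `a` NO admissible state on `E` hits the second target coordinate,
then every chord of `E` that is killable at `a` has both read vectors with second coordinate `0`.  (Canonical state "forced ON, killable OFF";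
a killable chord with a second-coordinate read would toggle the second coordinate.) -/
theorem unread_of_unreach_snd {E : Finset ι} {a : A} (hno : ∀ s, S.Adm E a s → (S.val E a s).2 ≠ S.t.2) {e : ι} (he : e ∈ E)
    (hu : S.u e a = 0) : (S.ρ e a).2 = 0 ∧ (S.ρ' e a).2 = 0 := by
  -- canonical admissible state
  let s₀ : ι → ZMod 2 × ZMod 2 := fun e' => (S.u e' a, 1)
  have hadm₀ : S.Adm E a s₀ := fun e' _ => by simp [s₀]
  set c := S.val (E.erase e) a s₀ with hc
  -- value with `e` in the killable state `x`
  have hval : ∀ x : ZMod 2 × ZMod 2, x.1 * x.2 = 0 →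
      (S.val E a (Function.update s₀ e x)).2 = x.1 * (S.ρ e a).2 + x.2 * (S.ρ' e a).2 + c.2 := by
    intro x hx
    rw [S.val_eq he, S.val_erase_update, S.contrib_update_self, ← hc, Prod.snd_add, Prod.snd_add, Prod.smul_snd, Prod.smul_snd,
      smul_eq_mul, smul_eq_mul]
  have hne : ∀ x : ZMod 2 × ZMod 2, x.1 * x.2 = 0 → x.1 * (S.ρ e a).2 + x.2 * (S.ρ' e a).2 + c.2 ≠ S.t.2 := by
    intro x hx h
    exact hno _ (S.adm_update (S.adm_erase hadm₀ e) (by rw [hx, hu])) (by rw [hval x hx]; exact h)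
  have h00 := hne (0, 0) (by simp)
  have h10 := hne (1, 0) (by simp)
  have h01 := hne (0, 1) (by simp)
  simp only [zero_mul, one_mul, add_zero, zero_add] at h00 h10 h01
  have key : ∀ r r' c t : ZMod 2, c ≠ t → r + c ≠ t → r' + c ≠ t → r = 0 ∧ r' = 0 := by decide
  exact key _ _ _ _ h00 h10 h01

/-- Under the same hypothesis the canonical state shows: the second coordinate of the state-free part plus the forced contributions misses the
target by one — `(F a).2 + Σ_{u_e(a) ≠ 0} (ρ_e + ρ'_e).2 = t.2 + 1`. -/
theorem snd_eq_of_unreach_snd {E : Finset ι} {a : A} (hno : ∀ s, S.Adm E a s → (S.val E a s).2 ≠ S.t.2) :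
    (S.F a).2 + ∑ e ∈ E.filter (fun e => ¬ S.u e a = 0), (S.ρ e a + S.ρ' e a).2 = S.t.2 + 1 := by
  let s₀ : ι → ZMod 2 × ZMod 2 := fun e' => (S.u e' a, 1)
  have hadm₀ : S.Adm E a s₀ := fun e' _ => by simp [s₀]
  have h := hno s₀ hadm₀
  -- the canonical value
  have hval : (S.val E a s₀).2 = (S.F a).2 + ∑ e ∈ E.filter (fun e => ¬ S.u e a = 0), (S.ρ e a + S.ρ' e a).2 := by
    unfold ChordSystem.val
    rw [Prod.snd_add, Prod.snd_sum, ← sum_filter_add_sum_filter_not E (fun e => S.u e a = 0)]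
    have hk : ∑ e ∈ E.filter (fun e => S.u e a = 0), (S.contrib a s₀ e).2 = 0 := by
      refine sum_eq_zero fun e he => ?_
      obtain ⟨heE, hue⟩ := mem_filter.1 he
      have hr := unread_of_unreach_snd S hno heE hue
      unfold ChordSystem.contrib
      rw [Prod.snd_add, Prod.smul_snd, Prod.smul_snd, hr.1, hr.2, smul_zero, smul_zero, add_zero]
    have hf : ∀ e ∈ E.filter (fun e => ¬ S.u e a = 0), (S.contrib a s₀ e).2 = (S.ρ e a + S.ρ' e a).2 := by
      intro e he
      obtain ⟨-, hue⟩ := mem_filter.1 he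
      have h1 : S.u e a = 1 := (zmod2_cases _).resolve_left hue
      unfold ChordSystem.contrib
      simp only [s₀, h1, one_smul]
    rw [hk, zero_add, sum_congr rfl hf]
  rw [hval] at h
  have e2 : ∀ p q : ZMod 2, p ≠ q → p = q + 1 := by decide
  exact e2 _ _ h

/-! ## Direction collapse for all chords but one -/

/-- **Direction collapse for the chords other than `e`.**  Infeasible system on `E`; every chord of `E` other than `e` has CONSTANT read vectors
`r, r'`; any two distinct chords of `E` other than `e` are killable at a common base point.  Then (U1) the reads of the chords other than `e` lie on
one line `{0, m}`, or (U2) exactly one of them is read, with two independent read vectors.  The read of `e` may vary with the base point — it is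
never used. -/
theorem direction_of_others {E : Finset ι} (hI : S.Infeasible E) (e : ι) {r r' : ι → V2}
    (hr : ∀ i ∈ E, i ≠ e → ∀ a, S.ρ i a = r i ∧ S.ρ' i a = r' i)
    (hK : ∀ i ∈ E, ∀ j ∈ E, i ≠ e → j ≠ e → i ≠ j → ∃ a, S.u i a = 0 ∧ S.u j a = 0) :
    (∃ m : V2, ∀ i ∈ E.erase e, (r i = 0 ∨ r i = m) ∧ (r' i = 0 ∨ r' i = m)) ∨
    (∃ i₀ ∈ E.erase e, r i₀ ≠ 0 ∧ r' i₀ ≠ 0 ∧ r i₀ ≠ r' i₀ ∧ ∀ i ∈ E.erase e, i ≠ i₀ → r i = 0 ∧ r' i = 0) := by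
  refine PstarChordSystem.ChordSystem.U1_or_U2_of_pairwise fun i hi j hj hij x y hx hy hx0 hy0 => ?_
  obtain ⟨hie, hiE⟩ := mem_erase.1 hi
  obtain ⟨hje, hjE⟩ := mem_erase.1 hj
  by_contra hxy
  obtain ⟨a, ha⟩ := hK i hiE j hjE hie hje hij
  have hx' : x = S.ρ i a ∨ x = S.ρ' i a := by rw [(hr i hiE hie a).1, (hr i hiE hie a).2]; exact hx
  have hy' : y = S.ρ j a ∨ y = S.ρ' j a := by rw [(hr j hjE hje a).1, (hr j hjE hje a).2]; exact hy
  exact not_killable_pair_at S hI hiE hjE hij a hx' hy' hx0 hy0 hxy ha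

/-- In case (U1) with at least two READ chords other than `e` the direction `m` is non-zero and every chord other than `e` that is read carries
`m` as its only non-zero read vector — bookkeeping form used downstream. -/
theorem read_eq_of_U1 {E : Finset ι} {e : ι} {r r' : ι → V2} {m : V2}
    (hU1 : ∀ i ∈ E.erase e, (r i = 0 ∨ r i = m) ∧ (r' i = 0 ∨ r' i = m)) {i : ι} (hi : i ∈ E.erase e) (hread : r i ≠ 0 ∨ r' i ≠ 0) :
    m ≠ 0 ∧ ∀ x : V2, (x = r i ∨ x = r' i) → x ≠ 0 → x = m := by
  obtain ⟨h1, h2⟩ := hU1 i hi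
  refine ⟨?_, ?_⟩
  · rintro rfl
    rcases hread with h | h
    · rcases h1 with h1 | h1 <;> exact h h1
    · rcases h2 with h2 | h2 <;> exact h h2
  · rintro x (rfl | rfl) hx0
    · exact h1.resolve_left hx0
    · exact h2.resolve_left hx0

/-! ## Chamber incompatibility -/

/-- **The gated chord is never co-killable with a transversely read chord inside its read chamber.**  At a base point `a` where `e` carries the
non-zero read vector `x` and `e' ≠ e` carries a non-zero read vector `y ≠ x`, the two chords are not both killable.  (Restatement of
`PstarChordBridgePointwise.not_killable_pair_at`; in the E2 configuration: `x = (1,0)` on the chamber `{ℓ = 1}`, `y = m` transverse, so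
`{ℓ = 1} ∩ Z(u_e) ∩ Z(u_{e'}) = ∅`.) -/
theorem not_cokillable_of_read {E : Finset ι} (hI : S.Infeasible E) {e e' : ι} (he : e ∈ E) (he' : e' ∈ E) (hne : e ≠ e') {a : A}
    {x y : V2} (hx : x = S.ρ e a ∨ x = S.ρ' e a) (hy : y = S.ρ e' a ∨ y = S.ρ' e' a) (hx0 : x ≠ 0) (hy0 : y ≠ 0) (hxy : x ≠ y)
    (hue : S.u e a = 0) : S.u e' a ≠ 0 :=
  fun hue' => not_killable_pair_at S hI he he' hne a hx hy hx0 hy0 hxy ⟨hue, hue'⟩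

/-- **Both chambers, packaged for the E2 gate.**  `e` is read at `a` exactly by the vector `x ≠ 0` in its first private (`ρ_e(a) = x`, second
private unread), `e' ≠ e` has a non-zero read `y` at `a`.  If `e` and `e'` are both killable at `a` then `y = x`: inside the read chamber of the
gate every co-killable chord reads PARALLEL to the gate. -/
theorem parallel_of_cokillable {E : Finset ι} (hI : S.Infeasible E) {e e' : ι} (he : e ∈ E) (he' : e' ∈ E) (hne : e ≠ e') {a : A}
    {x y : V2} (hρ : S.ρ e a = x) (hx0 : x ≠ 0) (hy : y = S.ρ e' a ∨ y = S.ρ' e' a) (hy0 : y ≠ 0)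
    (hue : S.u e a = 0) (hue' : S.u e' a = 0) : y = x := by
  by_contra hxy
  exact not_killable_pair_at S hI he he' hne a (Or.inl hρ.symm) hy hx0 hy0 (Ne.symm hxy) ⟨hue, hue'⟩

end Summit.PneNP.PneNP.Theorems.PstarGateDirection
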